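import Summits.QuantumFields.YangMills.Theorems.BalabanUVNodesN21ChartExponentCoercivity
import Literature.MathematicalPhysics.QuantumFieldTheory.Balaban1983to89.B16Eq18Proof

/-!
# N21 (NE7c) · THE (1.9) BINDER `h19` OF THE (M1) ENDs FROM PRINT's (1.7) ROW + THE TREE's PROVED (1.8) ON A
# RECTANGULAR PARALLELEPIPED — print's own shape of `Λ` (file 8 of WIDTH-209 N21 piece 2; box edition of file 6)

Width seat pub-ymgap-dag-n21-w3 (g5), node N21 = NE7c (single-run shell-weight bound, NOT PRINTED in [Bałaban 1983–89],
NOT proved), lane K3⁸ `SpineGivenEndpointR13SepCoPHV` (stmt-QuantumFields-27366, `--kind proof --supports … --as helper`;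
K3⁷ 20544 = aside ∕ lineage).  Box edition of file 6 `…N21ChartExponentCoercivity` (p616546).

WHY.  Print's (1.8) ([LF-II] = CMP 122 p. 358) is stated for *"Λ … a rectangular parallelepiped contained in a cube of
the size 100M"* — the domain of [IV] (1.73) p. 192, *"obtained by adding one layer of M-cubes to Z′_k"* — not for a cube.
File 6 read the (M1) ENDs' coercivity binder `h19 : ∀ v, Ineq19 (Qf v) (Σ v²) γ₀ d M` from the (1.7) row on the off-tree
chart of a CUBE `block n y`, through `B16Sect1Wilson.ineq18_cube_vec`, and its header repeated that file's stale line
«rectangular parallelepipeds are the Literature's TODO».  That sentence is wrong: the tree HOLDS (1.8) for rectangular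
parallelepipeds PROVED — `B16Eq18Proof.ineq18_box_vec` (lit-balaban Phase 2, 2026-08-21; carrier `box n y =
{x : y_i ≤ x_i < y_i + n_i}` with sides `n : Fin d → ℕ`, comb tree `B16Eq18Proof.treeBonds n y`, `box_const` ∕
`treeBonds_const`: a cube is the box `n = fun _ ↦ L`, by `rfl`).  This file is file 6 on that carrier: every theorem of
file 6 §1–§3, §5 for a box with ARBITRARY sides `n_i ≤ 100M` — and the side binder `1 ≤ n` of file 6 disappears (a box
with a zero side has an empty frame, on which everything is vacuous but true).  The lane referee's READ-248 NIT «the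
cube-only (1.8) vs an END's block shape» (INBOX l.36622) is thereby answered in substance.

WHAT (THEOREMS ONLY; 0 `def`, 0 `sorry`).  Carrier: `B16Eq18Proof` (`box n y`, its `innerBonds` ∕ `innerPlaq`, the comb
tree `treeBonds n y`) over `B6TreeGaugePoincare` (`Cfg`, `curl`); 𝔤-coordinates `Fin D`.
* §0 [folklore] `innerBonds_const` ∕ `innerPlaq_const`: the box carriers at constant sides ARE the cube carriers (`rfl`).
* §1 [folklore] extension by zero off a sub-finset `T ⊆ I` of ANY index type (file 6 §1 once for every carrier):
  `extendOffSubfinset_eq_zero` (zero on `T`), `sum_sq_extendOffSubfinset` (`Σ_{b∈I}Σ_a ext(v)_a(b)² = Σ_κ v²`); at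
  `I ∖ T = innerBonds n y ∖ treeBonds n y` this is the OFF-TREE BOX FRAME `κ = ↥(innerBonds n y ∖ treeBonds n y) × Fin D`.
* §2 ★ `ineq19_of_ineq17_treeGaugeBox` (ABSTRACT: any frame `κ`, any extension `E` vanishing on the box's tree and
  preserving the sum of squares) and ★ `ineq19_offTreeBox_of_ineq17` (§1's frame): from the (1.7) row
  `∀ v, Ineq17 (Qf v) (Σ_{p∈Λ}Σ_a (∂ E v_a)(p)²) (Σ_κ v²) γ₀ C M R_k ε_k`, `1 ≤ d`, `∀ i, n i ≤ 100M`, `1 ≤ M`, `0 ≤ γ₀`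
  and the smallness line `C(M⁶R_kε_k + e^{−R_k}) ≤ γ₀∕(2d(100M)^{d+1})` ⇒ `∀ v, Ineq19 (Qf v) (Σ_κ v²) γ₀ d M`.
* §3 ★★ `convexOn_treeGaugeBoxChart_expansion_of_ineq17_analyticSupBound`: file 4-local's (p611900) ★★′-loc with `h19`
  DISCHARGED by §2 on any tree-gauge-fixed BOX chart frame.
* §4 [knit] `ineq19_of_ineq17_treeGauge_of_box`: file 6's ★ `ineq19_of_ineq17_treeGauge` RE-DERIVED from §2 at
  `n = fun _ ↦ L` (carriers agree by §0), with file 6's binder `1 ≤ n` GONE.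
* §5 A6 `offTreeBox_frame_nonempty`: for a genuinely NON-CUBIC box (`d = 2`, sides `(3, 2)`) the off-tree frame is
  inhabited (the bond `⟨(y₀+1, y₁), (y₀+1, y₁+1)⟩`), so §2 is not about an empty index type there; and
  `ineq17_binders_inhabited_box`: §2's binder list is jointly inhabited NON-TRIVIALLY (`Qf := Σ(∂E v)²`, `γ₀ = 1`,
  `C = 0`), §2 then returning the rescaled (1.8) for boxes.

HONEST FRAMING.  [textbook]∕[folklore] over three Literature theorems BY NAME (`B16Eq18Proof.ineq18_box_vec`,
`B16Sect1Wilson.ineq19_of_17_18`, file 4-local).  (1.7) — positivity of `Δ₁(ζ₀)` with its `O(1)(M⁶R_kε_k + e^{−R_k})`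
correction — is a DISPLAYED ROW about NODE O's operator, NOT asserted; the identification of an END's `Qf` with «the
leading quadratic form ⟨H_{1,k}B′, Δ₁(ζ₀)H_{1,k}B′⟩» and of `κ` with the block's off-tree bond variables is LOCATED typing;
which box, corner and gauge tree the lane's (M1) package uses is dag-n21-w2 ∕ dag-n21-d's measure-side decision; the
dictionary to pub-balaban's torus bonds is the companion file `…CoercivityBoxSUN`; nothing of Bałaban's asserted; (M1) ∕
NE7c NOT PRINTED ∕ NOT proved; N21 NOT discharged; K3⁸ NOT claimed; counts unmoved (typed 28∕28 · discharged 5∕27);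
count-neutral; one finite 𝕋⁴ at fixed ε — the Yang–Mills mass gap (Clay) is NOT proved by any of this: R4 closes the
conditional finite-𝕋⁴ rung `BalabanLadder.UV` only; nothing continuum ∕ ℝ⁴ ∕ OS.
-/

set_option autoImplicit false

noncomputable section

open Set Function Finset Matrix Metric

namespace Summit.QuantumFields.YangMills.Theorems.N21ChartExponentCoercivityBox

open Literature.MathematicalPhysics.QuantumFieldTheory.Balaban1983to89
open Literature.MathematicalPhysics.QuantumFieldTheory.Balaban1983to89.B16Sect1Wilson
  (Ineq17 Ineq18 Ineq19 ineq19_of_17_18)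
open Literature.MathematicalPhysics.QuantumFieldTheory.Balaban1983to89.B6TreeGaugePoincare (Cfg curl)
open Literature.MathematicalPhysics.QuantumFieldTheory.Balaban1983to89.B6BondElimination (unitVec unitVec_apply)
open Literature.MathematicalPhysics.QuantumFieldTheory.Balaban1983to89.B16Eq18Proof
  (box mem_box treeBonds mem_treeBonds innerBonds mem_innerBonds innerPlaq treeBonds_subset_innerBonds ineq18_box_vec
    box_const treeBonds_const)
open Summit.QuantumFields.YangMills.Theorems.N21ChartExponentConvexityLocal (convexOn_expansion_of_analyticSupBound_local)

variable {d : ℕ}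

/-! ## §0  A cube is a box: the carriers at constant sides -/

section Const

/-- the inner bonds of the box with all sides `L` ARE the inner bonds of the cube `block L y` (definitionally). [folklore] -/
theorem innerBonds_const (L : ℕ) (y : Fin d → ℤ) :
    innerBonds (fun _ : Fin d => L) y = B6TreeGaugePoincare.innerBonds L y := rfl

/-- the inner plaquettes of the box with all sides `L` ARE the inner plaquettes of the cube `block L y`. [folklore] -/
theorem innerPlaq_const (L : ℕ) (y : Fin d → ℤ) :
    innerPlaq (fun _ : Fin d => L) y = B6TreeGaugePoincare.innerPlaq L y := rfl

end Const

/-! ## §1  Extension by zero off a sub-finset: the chart-frame bookkeeping, once for every carrier -/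

section Frame

variable {α : Type*} [DecidableEq α] {I T : Finset α} {D : ℕ}

/-- **EXTENSION BY ZERO OFF A SUB-FINSET VANISHES ON IT**: for finsets `T, I` of any index type, the extension by zero of
coordinates `v : ↥(I ∖ T) × Fin D → ℝ` is `0` at every `b ∈ T` — at `I, T` = the inner ∕ tree bonds of a box (or of a
cube, file 6 §1) this is «the chart vector extended by zero vanishes on `G₀`», the hypothesis of (1.8). [folklore] -/
theorem extendOffSubfinset_eq_zero (v : ↥(I \ T) × Fin D → ℝ) :
    ∀ b ∈ T, (fun a : Fin D => if h : b ∈ I \ T then v (⟨b, h⟩, a) else (0 : ℝ)) = 0 := by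
  intro b hb
  funext a
  have : b ∉ I \ T := fun h => (mem_sdiff.1 h).2 hb
  simp only [dif_neg this, Pi.zero_apply]

/-- **EXTENSION BY ZERO PRESERVES THE SUM OF SQUARES** over `I ⊇ T`: `Σ_{b∈I} Σ_a ext(v)_a(b)² = Σ_κ v²`, `κ = ↥(I ∖ T) × Fin D`
(the members of `T` contribute `0`, the members of `I ∖ T` are the coordinates) — file 6 §1's `sum_sq_extendOffTree` for
every carrier at once. [folklore] -/
theorem sum_sq_extendOffSubfinset (hTI : T ⊆ I) (v : ↥(I \ T) × Fin D → ℝ) :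
    ∑ b ∈ I, ∑ a : Fin D, (if h : b ∈ I \ T then v (⟨b, h⟩, a) else (0 : ℝ)) ^ 2 = ∑ i, v i ^ 2 := by
  rw [← sum_sdiff hTI]
  have hT : ∑ b ∈ T, ∑ a : Fin D, (if h : b ∈ I \ T then v (⟨b, h⟩, a) else (0 : ℝ)) ^ 2 = 0 := by
    refine sum_eq_zero fun b hb => sum_eq_zero fun a _ => ?_
    have : b ∉ I \ T := fun h => (mem_sdiff.1 h).2 hb
    simp only [dif_neg this]
    ring
  rw [hT, add_zero, ← sum_coe_sort (I \ T), Fintype.sum_prod_type]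
  refine sum_congr rfl fun b _ => sum_congr rfl fun a _ => ?_
  simp only [dif_pos b.2]

end Frame

/-! ## §2  ★ The (1.9) binder from the (1.7) row + PROVED (1.8) for boxes + the smallness line -/

section Coercivity

variable {n : Fin d → ℕ}

/-- ★ **(1.9) FROM (1.7) + PROVED (1.8), ABSTRACT TREE-GAUGE FRAME OF A RECTANGULAR PARALLELEPIPED.**  Let `κ` index
real chart coordinates and `E` extend a coordinate vector to a 𝔤-valued bond configuration on the box `Λ = box n y`
(sides `n_i ≤ 100M`, `1 ≤ M`) VANISHING ON THE TREE `G₀ = treeBonds n y` and PRESERVING the sum of squares.  If the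
quadratic member `Qf` obeys print's (1.7) row for every `v` — `γ₀·Σ_{p∈Λ}|(∂E v)(p)|² − C(M⁶R_kε_k + e^{−R_k})·Σ_κ v² ≤ Qf v`
— and the smallness line `C(M⁶R_kε_k + e^{−R_k}) ≤ γ₀∕(2d(100M)^{d+1})` holds («for g_k sufficiently small»), then the
ENDs' binder `∀ v, Ineq19 (Qf v) (Σ_κ v²) γ₀ d M` holds: (1.8) is the tree theorem `B16Eq18Proof.ineq18_box_vec`, the
implication is `B16Sect1Wilson.ineq19_of_17_18`. [cite: Balaban1989LargeFieldII, (1.7)–(1.9) p.358] [folklore] -/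
theorem ineq19_of_ineq17_treeGaugeBox {κ : Type*} [Fintype κ] {D : ℕ} (M : ℕ) (hd : 1 ≤ d)
    (hnM : ∀ i, n i ≤ 100 * M) (hM : 1 ≤ M) (y : Fin d → ℤ)
    (E : (κ → ℝ) → ((Fin d → ℤ) × Fin d → (Fin D → ℝ)))
    (hEtree : ∀ v, ∀ b ∈ treeBonds n y, E v b = 0)
    (hEsq : ∀ v, ∑ b ∈ innerBonds n y, ∑ a, E v b a ^ 2 = ∑ i, v i ^ 2)
    (Qf : (κ → ℝ) → ℝ) {γ₀ C Rk εk : ℝ} (hγ : 0 ≤ γ₀)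
    (h17 : ∀ v, Ineq17 (Qf v) (∑ p ∈ innerPlaq n y, ∑ a, curl (fun b => E v b a) p.1 p.2.1 p.2.2 ^ 2)
      (∑ i, v i ^ 2) γ₀ C M Rk εk)
    (hsmall : C * ((M : ℝ) ^ 6 * Rk * εk + Real.exp (-Rk)) ≤ γ₀ / (2 * d * (100 * (M : ℝ)) ^ (d + 1))) :
    ∀ v, Ineq19 (Qf v) (∑ i, v i ^ 2) γ₀ d M := by
  intro v
  have hM' : (0 : ℝ) < (M : ℝ) := by exact_mod_cast hM
  have hnB : (0 : ℝ) ≤ ∑ i, v i ^ 2 := Finset.sum_nonneg fun i _ => sq_nonneg (v i)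
  have h18 : Ineq18 (∑ i, v i ^ 2) (∑ p ∈ innerPlaq n y, ∑ a, curl (fun b => E v b a) p.1 p.2.1 p.2.2 ^ 2) d M := by
    have h := ineq18_box_vec (D := D) M hM hnM y (E v) (hEtree v)
    rw [hEsq v] at h
    exact h
  exact ineq19_of_17_18 hd hM' hγ hnB (h17 v) h18 hsmall

/-- ★ **(1.9) FROM (1.7) + PROVED (1.8) ON THE OFF-TREE CHART OF A BOX** `κ = ↥(innerBonds n y ∖ treeBonds n y) × Fin D`
(§1's extension by zero): the ENDs' `h19` read from the (1.7) row + the smallness line, sides `n_i ≤ 100M`.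
[cite: Balaban1989LargeFieldII, (1.7)–(1.9) p.358] [folklore] -/
theorem ineq19_offTreeBox_of_ineq17 {D : ℕ} (M : ℕ) (hd : 1 ≤ d) (hnM : ∀ i, n i ≤ 100 * M) (hM : 1 ≤ M)
    (y : Fin d → ℤ) (Qf : (↥(innerBonds n y \ treeBonds n y) × Fin D → ℝ) → ℝ) {γ₀ C Rk εk : ℝ} (hγ : 0 ≤ γ₀)
    (h17 : ∀ v, Ineq17 (Qf v)
      (∑ p ∈ innerPlaq n y, ∑ a : Fin D,
        curl (fun b => if h : b ∈ innerBonds n y \ treeBonds n y then v (⟨b, h⟩, a) else (0 : ℝ)) p.1 p.2.1 p.2.2 ^ 2)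
      (∑ i, v i ^ 2) γ₀ C M Rk εk)
    (hsmall : C * ((M : ℝ) ^ 6 * Rk * εk + Real.exp (-Rk)) ≤ γ₀ / (2 * d * (100 * (M : ℝ)) ^ (d + 1))) :
    ∀ v, Ineq19 (Qf v) (∑ i, v i ^ 2) γ₀ d M := by
  intro v
  have hM' : (0 : ℝ) < (M : ℝ) := by exact_mod_cast hM
  have hnB : (0 : ℝ) ≤ ∑ i, v i ^ 2 := Finset.sum_nonneg fun i _ => sq_nonneg (v i)
  -- (1.8) for boxes applied to the extension by zero of `v` (zero on the tree), read back on the chart coordinates by §1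
  have h18raw := ineq18_box_vec (D := D) M hM hnM y
    (fun (b : (Fin d → ℤ) × Fin d) (a : Fin D) => if h : b ∈ innerBonds n y \ treeBonds n y then v (⟨b, h⟩, a) else (0 : ℝ))
    (extendOffSubfinset_eq_zero v)
  rw [sum_sq_extendOffSubfinset (treeBonds_subset_innerBonds (n := n) y) v] at h18raw
  exact ineq19_of_17_18 hd hM' hγ hnB (h17 v) h18raw hsmall

end Coercivity

/-! ## §3  ★★ Convexity of the (1.2)-shaped exponent on a tree-gauge-fixed BOX chart from the (1.7) row -/

section Convexity

variable {n : Fin d → ℕ}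

/-- ★★ **CONVEXITY OF THE (1.2)-SHAPED EXPONENT FROM THE (1.7) ROW, BOX FRAME** (file 4-local's ★★′-loc with `h19`
DISCHARGED by §2): on a convex cut `K` of ANY tree-gauge-fixed chart frame `κ` of the box `Λ = box n y` (extension `E`
zero on `G₀`, sum of squares preserved), `φ = c + ½·Qf + lin + Vt` with `Qf v = v ⬝ᵥ (A *ᵥ v)` obeying the (1.7) row
for every `v`, `lin = ⇑ℓ`, `Vt = Re Φ∘ι` with `Φ` ℂ-differentiable and `‖Φ‖ ≤ S` on the `r`-ball about every real point
of `K` (`0 < r`), the smallness line and the clause `4·d·(100M)^{d+1}·S ≤ γ₀·r²` ⇒ `ConvexOn ℝ K φ`.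
[cite: Balaban1989LargeFieldII, (1.7)–(1.9) p.358] [textbook] -/
theorem convexOn_treeGaugeBoxChart_expansion_of_ineq17_analyticSupBound {κ : Type*} [Fintype κ] {D : ℕ} (M : ℕ)
    (hd : 1 ≤ d) (hnM : ∀ i, n i ≤ 100 * M) (hM : 1 ≤ M) (y : Fin d → ℤ)
    (E : (κ → ℝ) → ((Fin d → ℤ) × Fin d → (Fin D → ℝ)))
    (hEtree : ∀ v, ∀ b ∈ treeBonds n y, E v b = 0)
    (hEsq : ∀ v, ∑ b ∈ innerBonds n y, ∑ a, E v b a ^ 2 = ∑ i, v i ^ 2)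
    {K : Set (κ → ℝ)} (hK : Convex ℝ K)
    (φ Qf lin Vt : (κ → ℝ) → ℝ) (c : ℝ) (hexp : ∀ v ∈ K, φ v = c + 1 / 2 * Qf v + lin v + Vt v)
    (A : Matrix κ κ ℝ) (hQf : ∀ v, Qf v = v ⬝ᵥ (A *ᵥ v))
    {γ₀ C Rk εk : ℝ} (hγ : 0 ≤ γ₀)
    (h17 : ∀ v, Ineq17 (Qf v) (∑ p ∈ innerPlaq n y, ∑ a, curl (fun b => E v b a) p.1 p.2.1 p.2.2 ^ 2)
      (∑ i, v i ^ 2) γ₀ C M Rk εk)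
    (hsmall : C * ((M : ℝ) ^ 6 * Rk * εk + Real.exp (-Rk)) ≤ γ₀ / (2 * d * (100 * (M : ℝ)) ^ (d + 1)))
    (ℓ : (κ → ℝ) →ₗ[ℝ] ℝ) (hlin : ∀ v, lin v = ℓ v)
    (Φ : (κ → ℂ) → ℂ) {r S : ℝ} (hr : 0 < r) (hVt : ∀ x ∈ K, Vt x = (Φ fun i => (x i : ℂ)).re)
    (hΦd : ∀ x ∈ K, DifferentiableOn ℂ Φ (ball (fun i => (x i : ℂ)) r))
    (hΦS : ∀ x ∈ K, ∀ u ∈ ball (fun i => (x i : ℂ)) r, ‖Φ u‖ ≤ S)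
    (hclause : 4 * d * (100 * (M : ℝ)) ^ (d + 1) * S ≤ γ₀ * r ^ 2) :
    ConvexOn ℝ K φ :=
  convexOn_expansion_of_analyticSupBound_local hK φ Qf lin Vt c hexp A hQf hd (by exact_mod_cast hM)
    (ineq19_of_ineq17_treeGaugeBox M hd hnM hM y E hEtree hEsq Qf hγ h17 hsmall) ℓ hlin Φ hr hVt hΦd hΦS hclause

end Convexity

/-! ## §4  Knit: file 6's cube theorem is the box theorem at constant sides — its `1 ≤ n` binder gone -/

section Knit

/-- **FILE 6's ★ FROM THE BOX ★** (`n = fun _ ↦ L`; the carriers agree by §0 ∕ `treeBonds_const`): the cube statement of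
`N21ChartExponentCoercivity.ineq19_of_ineq17_treeGauge` with its hypothesis `1 ≤ n` REMOVED (a cube of side `0` is an
empty frame; nothing else changes). [cite: Balaban1989LargeFieldII, (1.7)–(1.9) p.358] [folklore] -/
theorem ineq19_of_ineq17_treeGauge_of_box {κ : Type*} [Fintype κ] {L D : ℕ} (M : ℕ) (hd : 1 ≤ d)
    (hLM : L ≤ 100 * M) (hM : 1 ≤ M) (y : Fin d → ℤ)
    (E : (κ → ℝ) → ((Fin d → ℤ) × Fin d → (Fin D → ℝ)))
    (hEtree : ∀ v, ∀ b ∈ B6BondElimination.treeBonds L y, E v b = 0)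
    (hEsq : ∀ v, ∑ b ∈ B6TreeGaugePoincare.innerBonds L y, ∑ a, E v b a ^ 2 = ∑ i, v i ^ 2)
    (Qf : (κ → ℝ) → ℝ) {γ₀ C Rk εk : ℝ} (hγ : 0 ≤ γ₀)
    (h17 : ∀ v, Ineq17 (Qf v)
      (∑ p ∈ B6TreeGaugePoincare.innerPlaq L y, ∑ a, curl (fun b => E v b a) p.1 p.2.1 p.2.2 ^ 2)
      (∑ i, v i ^ 2) γ₀ C M Rk εk)
    (hsmall : C * ((M : ℝ) ^ 6 * Rk * εk + Real.exp (-Rk)) ≤ γ₀ / (2 * d * (100 * (M : ℝ)) ^ (d + 1))) :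
    ∀ v, Ineq19 (Qf v) (∑ i, v i ^ 2) γ₀ d M := by
  rw [← treeBonds_const] at hEtree
  rw [← innerBonds_const] at hEsq
  rw [← innerPlaq_const] at h17
  exact ineq19_of_ineq17_treeGaugeBox M hd (fun _ => hLM) hM y E hEtree hEsq Qf hγ h17 hsmall

end Knit

/-! ## §5  A6: the off-tree frame of a NON-CUBIC box is inhabited; §2's binder list is jointly inhabited -/

section Witness

/-- **A6 (a genuinely rectangular box)**: in `d = 2` with sides `(3, 2)` at corner `y`, the bond
`⟨(y₀+1, y₁), (y₀+1, y₁+1)⟩` (direction `e₁` from the site one step off the corner in direction `e₀`) lies INSIDE the box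
and OFF its comb tree `G₀` (tree bonds of direction `e₁` start on the line `x₀ = y₀`) — so the off-tree box frame of §1 ∕ §2
is NOT an empty index type for non-cubic boxes. [folklore] -/
theorem offTreeBox_frame_nonempty (y : Fin 2 → ℤ) :
    ((y + unitVec (0 : Fin 2), (1 : Fin 2)) : (Fin 2 → ℤ) × Fin 2) ∈
      innerBonds (![3, 2] : Fin 2 → ℕ) y \ treeBonds (![3, 2] : Fin 2 → ℕ) y := by
  have h0 : (y + unitVec (0 : Fin 2)) 0 = y 0 + 1 := by simp [unitVec_apply]
  have h1 : (y + unitVec (0 : Fin 2)) 1 = y 1 := by simp [unitVec_apply]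
  have hn0 : (((![3, 2] : Fin 2 → ℕ) 0 : ℕ) : ℤ) = 3 := by norm_num
  have hn1 : (((![3, 2] : Fin 2 → ℕ) 1 : ℕ) : ℤ) = 2 := by norm_num
  have hbox : y + unitVec (0 : Fin 2) ∈ box (![3, 2] : Fin 2 → ℕ) y := by
    refine mem_box.2 (Fin.forall_fin_two.2 ⟨?_, ?_⟩)
    · rw [h0, hn0]
      omega
    · rw [h1, hn1]
      omega
  refine mem_sdiff.2 ⟨mem_innerBonds.2 ⟨hbox, ?_⟩, fun ht => ?_⟩
  · show (y + unitVec (0 : Fin 2)) 1 + 1 < y 1 + (((![3, 2] : Fin 2 → ℕ) 1 : ℕ) : ℤ)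
    rw [h1, hn1]
    omega
  · -- a tree bond of direction `e₁` starts on the line `x₀ = y₀`
    have h : (y + unitVec (0 : Fin 2)) 0 = y 0 := (mem_treeBonds.1 ht).2.1 0 (show (0 : Fin 2) < 1 by decide)
    rw [h0] at h
    omega

/-- **A6**: the hypotheses of ★ `ineq19_of_ineq17_treeGaugeBox` are jointly inhabited NON-TRIVIALLY on any box frame —
take the quadratic member `Qf v := Σ_{p∈Λ}|(∂E v)(p)|²` itself (`γ₀ = 1`, `C = 0`: (1.7) with equality, the smallness
line `0 ≤ …`); ★ then returns the rescaled (1.8) for the box: `Σ_κ v² ∕ (2d(100M)^{d+1}) ≤ Σ_{p∈Λ}|(∂E v)(p)|²`. [folklore] -/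
theorem ineq17_binders_inhabited_box {κ : Type*} [Fintype κ] {n : Fin d → ℕ} {D : ℕ} (M : ℕ) (hd : 1 ≤ d)
    (hnM : ∀ i, n i ≤ 100 * M) (hM : 1 ≤ M) (y : Fin d → ℤ)
    (E : (κ → ℝ) → ((Fin d → ℤ) × Fin d → (Fin D → ℝ)))
    (hEtree : ∀ v, ∀ b ∈ treeBonds n y, E v b = 0)
    (hEsq : ∀ v, ∑ b ∈ innerBonds n y, ∑ a, E v b a ^ 2 = ∑ i, v i ^ 2) (Rk εk : ℝ) :
    (∀ v, Ineq17 (∑ p ∈ innerPlaq n y, ∑ a, curl (fun b => E v b a) p.1 p.2.1 p.2.2 ^ 2)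
      (∑ p ∈ innerPlaq n y, ∑ a, curl (fun b => E v b a) p.1 p.2.1 p.2.2 ^ 2) (∑ i, v i ^ 2) 1 0 M Rk εk) ∧
    (0 : ℝ) * ((M : ℝ) ^ 6 * Rk * εk + Real.exp (-Rk)) ≤ 1 / (2 * d * (100 * (M : ℝ)) ^ (d + 1)) ∧
    ∀ v, Ineq19 (∑ p ∈ innerPlaq n y, ∑ a, curl (fun b => E v b a) p.1 p.2.1 p.2.2 ^ 2) (∑ i, v i ^ 2) 1 d M := by
  have h17 : ∀ v, Ineq17 (∑ p ∈ innerPlaq n y, ∑ a, curl (fun b => E v b a) p.1 p.2.1 p.2.2 ^ 2)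
      (∑ p ∈ innerPlaq n y, ∑ a, curl (fun b => E v b a) p.1 p.2.1 p.2.2 ^ 2) (∑ i, v i ^ 2) 1 0 M Rk εk := by
    intro v
    unfold Ineq17
    simp
  have hsmall : (0 : ℝ) * ((M : ℝ) ^ 6 * Rk * εk + Real.exp (-Rk)) ≤ 1 / (2 * d * (100 * (M : ℝ)) ^ (d + 1)) := by
    rw [zero_mul]
    have hd0 : (0 : ℝ) < d := by exact_mod_cast hd
    have hM0 : (0 : ℝ) < M := by exact_mod_cast hM
    positivity
  exact ⟨h17, hsmall, ineq19_of_ineq17_treeGaugeBox M hd hnM hM y E hEtree hEsq _ zero_le_one h17 hsmall⟩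

end Witness

end Summit.QuantumFields.YangMills.Theorems.N21ChartExponentCoercivityBox

end
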